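import Mathlib
import Summits.Parity.GeneralizedHardyLittlewood.Theorems.FordMaynardSieveConst01651SieveConst01651BuchstabCert
import HarnessLib

/-!
# Route `FordMaynardSieveConst01651`, target `SieveConst01651` (stmt-Parity-19185), stub `stub_certValuePos` (R2):
# kernel check — negative entries sit on uncut cells and their outer rectangles are the plain `2 × 2` tiling

Def-free helper file (step (5) of the `certP`/`certN` soundness, see `…CertAssembly`).  No entry with `c < 0` lies on
a cut cell (`a + b ∉ {35, 36, 71}`); an entry with `c < 0` either sits outside the half line (`a + b ≥ 72`, no rectangles,
empty region) or (`a + b ≤ 70`) its outer rectangle list is EXACTLY the four boxes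
`[E_a, E_a+142) ∪ [E_a+142, E_a+283)` × `[E_b, E_b+142) ∪ [E_b+142, E_b+283)` (`E_a = 19812 + 283a`), which tile the
half-open cell square — so the cover step of the upper bound needs no geometry of the band / half lines
(`certRectsNeg_all`, kernel `decide`; `certRectsNeg_eq` unpacks it).

References: folklore.
-/

namespace Summit.Parity.GeneralizedHardyLittlewood.FordMaynardSieveConst01651SieveConst01651

/-- **Outer rectangles of negative entries are the `2 × 2` tiling of the cell square** (kernel evaluation). [folklore] -/
theorem certRectsNeg_all :
    (certG2.all fun e => !decide (e.2.2.2 < 0) ||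
      (decide (72 ≤ e.1 + e.2.1) && decide (entryRects e.1 e.2.1 e.2.2.1 false = [])) ||
      (decide (e.1 + e.2.1 ≤ 70) && decide (entryRects e.1 e.2.1 e.2.2.1 false =
        [(19812 + e.1 * 283, 19812 + e.1 * 283 + 142, 19812 + e.2.1 * 283, 19812 + e.2.1 * 283 + 142),
         (19812 + e.1 * 283, 19812 + e.1 * 283 + 142, 19812 + e.2.1 * 283 + 142, 19812 + e.2.1 * 283 + 283),
         (19812 + e.1 * 283 + 142, 19812 + e.1 * 283 + 283, 19812 + e.2.1 * 283, 19812 + e.2.1 * 283 + 142),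
         (19812 + e.1 * 283 + 142, 19812 + e.1 * 283 + 283, 19812 + e.2.1 * 283 + 142, 19812 + e.2.1 * 283 + 283)]))) =
      true := by
  decide +kernel

/-- The outer rectangles of a negative entry: none on a cell outside the half line (`a + b ≥ 72`), else the
`2 × 2` tiling of the (uncut, `a + b ≤ 70`) cell square. [folklore] -/
theorem certRectsNeg_eq {e : ℕ × ℕ × ℕ × ℤ} (he : e ∈ certG2) (hc : e.2.2.2 < 0) :
    (72 ≤ e.1 + e.2.1 ∧ entryRects e.1 e.2.1 e.2.2.1 false = []) ∨
    (e.1 + e.2.1 ≤ 70 ∧ entryRects e.1 e.2.1 e.2.2.1 false =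
      [(19812 + e.1 * 283, 19812 + e.1 * 283 + 142, 19812 + e.2.1 * 283, 19812 + e.2.1 * 283 + 142),
       (19812 + e.1 * 283, 19812 + e.1 * 283 + 142, 19812 + e.2.1 * 283 + 142, 19812 + e.2.1 * 283 + 283),
       (19812 + e.1 * 283 + 142, 19812 + e.1 * 283 + 283, 19812 + e.2.1 * 283, 19812 + e.2.1 * 283 + 142),
       (19812 + e.1 * 283 + 142, 19812 + e.1 * 283 + 283, 19812 + e.2.1 * 283 + 142, 19812 + e.2.1 * 283 + 283)]) := by
  have h := certRectsNeg_all
  rw [List.all_eq_true] at h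
  have h1 := h e he
  simp only [Bool.or_eq_true, Bool.and_eq_true, Bool.not_eq_true', decide_eq_false_iff_not, decide_eq_true_eq] at h1
  rcases h1 with (h1 | h1) | h1
  · exact absurd hc h1
  · exact Or.inl h1
  · exact Or.inr h1

end Summit.Parity.GeneralizedHardyLittlewood.FordMaynardSieveConst01651SieveConst01651
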